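import Literature.MathematicalPhysics.QuantumFieldTheory.Balaban1983to89.Beta.RemainderChartOriginDerivative
import Literature.MathematicalPhysics.QuantumFieldTheory.Balaban1983to89.Beta.RemainderOriginBaseLetters

/-!
# Bałaban, *The variational problem and background fields in renormalization group method for lattice gauge
# theories*, Commun. Math. Phys. **102** (1985) 277–309 — (190) for the ACTUAL derivative `(δ/δB)𝓗(0)` of the
# (179)-chart FROM THE BASE LETTERS of [5] in the background: the chart corollary of `Beta.RemainderOriginBaseLetters`

CITATION HEADER (lean-in-tree rule 2026-08-18).  Source: T. Bałaban, Commun. Math. Phys. **102** (1985) 277–309,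
doi:10.1007/BF01229381 [Balaban1985Variational] (cell paper B11 = [15] of [Balaban1987RG1]); its ref. [5] =
[Balaban1985BackgroundPropagators] (Commun. Math. Phys. **99** (1985) 389–434); its ref. [3] = [Balaban1984PropagatorsII]
(Commun. Math. Phys. **96** (1984) 223–250).  Passages: (179)–(180) p. 306, (182) p. 307, (190) p. 308 (quoted in the two
imported siblings); p. 306 after (179) *"the new operator G has exactly the same properties as Δ_a⁻¹"*; [5] (3.42) p. 397,
(3.132)–(3.133) p. 422, (3.137) p. 423; [3] Lemma 2.1 (2.61) p. 234.

WHY THIS FILE (audit cell `pub-balaban`, BINDER row (D4), OWNER lineage `b2b-balaban-beta-an4`, gen 105).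
`Beta.RemainderChartOriginDerivative.ineq190_fderiv_chartH179_zero_of_letters` reads the (190) letter of the ACTUAL derivative of the
(179)-chart at `B = 0` off three letters `hH0`, `hG`, `hD2H0`; `Beta.RemainderOriginBaseLetters.ineq190_origin_of_base_letters`
produces the majorant of the OPERATOR `H₀ + G̃Δ⁽²⁾H₀` from the base letters of [5] in the background.  This file is the
three-line junction: by `Beta.RemainderChartOriginDerivative.restrictScalars_fderiv_chartH179_zero` the derivative IS that
operator, so **`ineq190_fderiv_chartH179_zero_of_base_letters`**: `Ineq190 bB bN ((δ/δB)𝓗(0)) (A₀ + κ₃B_G̃θ_Dc) δ` from (L1)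
`hH0` — (3.133) for `H₀`; (L2) `hG0` — [5] Thm 3.3 (3.42), first entry, for `G₀ = Δ_a⁻¹`; (L3) `hInv` — (3.132)-shape for
`(QG′Q*)⁻¹`; (L4) the locality of `Δ⁽²⁾` ((3.137)), `Q`, `Q*`; (L5) the resolvent identity `G′ = G₀ + G₀Δ⁽²⁾G′` of the new
`G′ = (Δ_a − Δ⁽²⁾)⁻¹` with an a priori bound (automatic on finite carriers — `…BaseLetters` §5) and `G̃ = G′ − G′Q*·Inv·QG′`
((131)/(143)); (L6) ONE smallness `q < 1`; (L7) (2.54) + (2.61).  NO (189), NO (187)–(188), NO letter of `H` or `𝔇`.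

HONEST SCOPE.  A corollary (rewrite + one application); nothing of [5] or [15] is proved; the letters are hypotheses of the
printed SHAPE; nothing identifies Bałaban's step-`k` operators with tree terms (NODE O).  Row (D4) class UNCHANGED (instance
0∕1; D4 DISCHARGE NO DATE); NOT B12 Thm 2, NOT BetaPertH, NOT continuum, NOT Clay.  HONEST DEPENDENCY (cell line): continuum YM
on T⁴ ⇐ BetaPertH ∧ nine spine estimates (0/9 proved); BetaPertH ⇐ (D1) ∧ (D4) ∧ CAP+tail; G-an2-4 gates asym, D1 and NE2/3/4.
NEW file importing `Beta.RemainderChartOriginDerivative` + `Beta.RemainderOriginBaseLetters` only; nothing modified; 0 `def`;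
standard axioms; no `sorry`.
-/

namespace Literature.MathematicalPhysics.QuantumFieldTheory.Balaban1983to89.Beta.RemainderOriginBaseLettersChart

open Literature.MathematicalPhysics.QuantumFieldTheory.Balaban1983to89 B11SectG
open Literature.MathematicalPhysics.QuantumFieldTheory.Balaban1983to89.B6RandomWalk (Triangle254)
open Literature.MathematicalPhysics.QuantumFieldTheory.Balaban1983to89.B11Eq174Chart (Regime)
open Literature.MathematicalPhysics.QuantumFieldTheory.Balaban1983to89.B11Eq183Differentiation (chartH179)
open Literature.MathematicalPhysics.QuantumFieldTheory.Balaban1983to89.Beta.RemainderChartOriginDerivative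
  (restrictScalars_fderiv_chartH179_zero)
open Literature.MathematicalPhysics.QuantumFieldTheory.Balaban1983to89.Beta.RemainderOriginBaseLetters
  (ineq190_origin_of_base_letters)

noncomputable section

variable {𝒳 𝒴 𝒵 : Type} [NormedAddCommGroup 𝒳] [NormedSpace ℂ 𝒳] [NormedAddCommGroup 𝒴] [NormedSpace ℂ 𝒴]
  [NormedAddCommGroup 𝒵] [NormedSpace ℂ 𝒵] [CompleteSpace 𝒳] [CompleteSpace 𝒴] [CompleteSpace 𝒵]
  {𝒢 : 𝒵 →L[ℂ] 𝒴} {W : 𝒴 → 𝒵} {D2 : 𝒴 →L[ℂ] 𝒵} {H₀ : 𝒳 →L[ℂ] 𝒴} {B₀ θ C₄ a₃ j a ε₄ : ℝ}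
  {g : B6.Geometry} {bB : BlockNorm g 𝒳} {bN : BlockNorm g 𝒴} {b3 : BlockNorm g 𝒵}
  {FQ : Type} [AddCommGroup FQ] [Module ℝ FQ] {bQ bQ' : BlockNorm g FQ}

/-- **THE (190) LETTER OF THE ACTUAL DERIVATIVE `(δ/δB)𝓗(0)` FROM THE BASE LETTERS OF [5] IN THE BACKGROUND.**  In the regime
of (180) (`R`, `W` analytic, `Tm` the Sect. C map with `DTm(0) = 1`), with `H₀`, `Δ⁽²⁾`, `G̃ = 𝒢` the chart's data read over `ℝ`:
from (L1) `hH0` ((3.133)-shape, rate `δ₀`), (L2) `hG0` ([5] Thm 3.3 (3.42) entry 0 for `G₀ = Δ_a⁻¹`, rate `δ₁`), (L4) `Δ⁽²⁾`, `Q`, `Q*`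
LOCAL (ranges `r_D`, `r_Q`; row∕column sums `λ`, `ν_Q`, `ν_{Q*}`), (L5) the resolvent identity of the new `G′` + an a priori bound
`M₀` + `𝒢 = G′ − G′Q*·Inv·QG′`, (L3) `hInv` ((3.132)-shape, rate `δ_I`), (L6) `q = κ_Nκ₃Bλe^{δ₁r_D}c < 1`, (L7) (2.54) + (2.61) at
the rate `σ` with constant `c`: `Ineq190 bB bN ((δ/δB)𝓗(0)) (A₀ + κ₃B_G̃θ_Dc) δ` for `δ/8 ≤ ρ ≤ δ₀`, `ρ + 3σ ≤ min(δ₁, δ_I)`,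
`θ_D = κ_NA₀λe^{δ₀r_D}`, `B_{G′} = B(1 − q)⁻¹`, `B_G̃ = B_{G′} + κ_Nκ₃κ_Qκ_{Q′}ν_Qν_{Q*}B_IB_{G′}²e^{2(ρ+2σ)r_Q}c²`.
[cite: Balaban1985Variational, (179)–(180) p.306, (182) p.307, (190) p.308, (129)–(131) pp.297–298, (143) p.300; Balaban1985BackgroundPropagators, Thm 3.3 (3.42) p.397+p.399, (3.132)–(3.133) p.422, (3.137)–(3.138) p.423; Balaban1984PropagatorsII, (2.54) p.233, Lemma 2.1 (2.61) p.234] -/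
theorem ineq190_fderiv_chartH179_zero_of_base_letters (R : Regime 𝒢 0 W B₀ θ C₄ a₃ j a ε₄)
    (hWa : AnalyticOnNhd ℂ W {Y : 𝒴 | ‖Y‖ < a₃}) (hj : 0 < j) (ha : 0 < a)
    {Tm : 𝒴 → 𝒴} (hTm : HasFDerivAt Tm (ContinuousLinearMap.id ℂ 𝒴) 0)
    {G0 G' : 𝒵 →ₗ[ℝ] 𝒴} {Q : 𝒴 →ₗ[ℝ] FQ} {Qs : FQ →ₗ[ℝ] 𝒵} {Inv : FQ →ₗ[ℝ] FQ} {KD KQ KQs : g.Site → g.Site → ℝ}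
    {A₀ δ₀ B δ₁ M₀ BI δI lam rD νQ νs rQ ρ σ c q BG' BGt θD δ : ℝ}
    (htri : Triangle254 g) (hd : ∀ a b : g.Site, 0 ≤ g.dist a b) (hrow : RowSum g σ c) (hc : 0 ≤ c)
    (hσ : 0 ≤ σ) (hρ : 0 ≤ ρ) (hρ₀ : ρ ≤ δ₀) (hρ₁ : ρ + 3 * σ ≤ δ₁) (hρI : ρ + 3 * σ ≤ δI) (hδ : δ / 8 ≤ ρ)
    (hA₀ : 0 ≤ A₀) (hδ₀ : 0 ≤ δ₀) (hB : 0 ≤ B) (hM₀ : 0 ≤ M₀) (hBI : 0 ≤ BI) (hlam : 0 ≤ lam)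
    (hνQ : 0 ≤ νQ) (hνs : 0 ≤ νs)
    (hH0 : HasMaj bB bN (H₀.restrictScalars ℝ : 𝒳 →ₗ[ℝ] 𝒴) (fun a b => A₀ * Real.exp (-(δ₀ * g.dist a b))))
    (hKD : ∀ a b, 0 ≤ KD a b) (hDloc : ∀ a b, KD a b ≠ 0 → g.dist a b ≤ rD)
    (hDrow : ∀ a, ∑ b : g.Site, KD a b ≤ lam) (hDcol : ∀ b, ∑ a : g.Site, KD a b ≤ lam)
    (hD2 : HasMaj bN b3 (D2.restrictScalars ℝ : 𝒴 →ₗ[ℝ] 𝒵) KD)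
    (hG0 : HasMaj b3 bN G0 (fun a b => B * Real.exp (-(δ₁ * g.dist a b))))
    (hfix : G' = G0 + (G0 ∘ₗ (D2.restrictScalars ℝ : 𝒴 →ₗ[ℝ] 𝒵)) ∘ₗ G') (hap : HasMaj b3 bN G' (fun _ _ => M₀))
    (hq_def : q = bN.κ * (b3.κ * B * lam * Real.exp (δ₁ * rD)) * c) (hq : q < 1) (hBG' : BG' = B * (1 - q)⁻¹)
    (hGt : (𝒢.restrictScalars ℝ : 𝒵 →ₗ[ℝ] 𝒴) = G' - (G' ∘ₗ Qs) ∘ₗ Inv ∘ₗ (Q ∘ₗ G'))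
    (hKQ : ∀ a b, 0 ≤ KQ a b) (hQloc : ∀ a b, KQ a b ≠ 0 → g.dist a b ≤ rQ)
    (hQrow : ∀ a, ∑ b : g.Site, KQ a b ≤ νQ) (hQ : HasMaj bN bQ Q KQ)
    (hKQs : ∀ a b, 0 ≤ KQs a b) (hQsloc : ∀ a b, KQs a b ≠ 0 → g.dist a b ≤ rQ)
    (hQscol : ∀ b, ∑ a : g.Site, KQs a b ≤ νs) (hQs : HasMaj bQ' b3 Qs KQs)
    (hInv : HasMaj bQ bQ' Inv (fun a b => BI * Real.exp (-(δI * g.dist a b))))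
    (hBGt : BGt = BG' + bN.κ * b3.κ * bQ.κ * bQ'.κ * νQ * νs * BI * BG' * BG' *
      Real.exp ((ρ + 2 * σ) * rQ) * Real.exp ((ρ + 2 * σ) * rQ) * c * c)
    (hθD : θD = bN.κ * A₀ * lam * Real.exp (δ₀ * rD)) :
    Ineq190 bB bN
      (((fderiv ℂ (chartH179 𝒢 W D2 H₀ Tm ε₄) (0 : 𝒳)).restrictScalars ℝ : 𝒳 →ₗ[ℝ] 𝒴))
      (A₀ + b3.κ * BGt * θD * c) δ := by
  rw [restrictScalars_fderiv_chartH179_zero R hWa hj ha hTm]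
  have h := ineq190_origin_of_base_letters (Gt := (𝒢.restrictScalars ℝ : 𝒵 →ₗ[ℝ] 𝒴))
    (H0 := (H₀.restrictScalars ℝ : 𝒳 →ₗ[ℝ] 𝒴)) (D2 := (D2.restrictScalars ℝ : 𝒴 →ₗ[ℝ] 𝒵))
    htri hd hrow hc hσ hρ hρ₀ hρ₁ hρI hδ hA₀ hδ₀ hB hM₀ hBI hlam hνQ hνs hH0 hKD hDloc hDrow hDcol hD2 hG0 hfix hap hq_def hq
    hBG' hGt hKQ hQloc hQrow hQ hKQs hQsloc hQscol hQs hInv hBGt hθD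
  exact (show HasMaj _ _ _ _ from h).congr fun _ => rfl

end

end Literature.MathematicalPhysics.QuantumFieldTheory.Balaban1983to89.Beta.RemainderOriginBaseLettersChart
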